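import Literature.AnabelianGeometry.EtaleTheta.Discharge.Sec2MonodromyModelHatRotationClosure
import HarnessLib

/-!
# [EtTh] Prop. 2.6, profinite clause, at the monodromy model — part 2: the SCALING AUTOMORPHISMS `Σ_ρ` of `Π_C = (TG l)^∧`
# extending an arbitrary topological automorphism `ρ` of the rotation closure `R = cl(η⟨t⟩)` (proof-only)

S. Mochizuki, *The étale theta function and its Frobenioid-theoretic manifestations* [EtTh], Publ. RIMS **45** (2009), §2
Prop. 2.6, PDF p. 40, last sentence: «A similar statement holds when "`Π^tp`" is replaced by "`Π`".» [cite: MochizukiEtTh2009, Prop 2.6 p.40].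
Cell abc-iut, block F, seat abc-iut-f-142 (gen 13), FACT-LIST row **F-0611** `TemperedCoverData.Prop26_profinite` — instance form at
abc-iut-w6-d084's monodromy model; sequel of `Sec2MonodromyModelHatRotationClosure.lean` (part 1).

WHAT IS PROVED (pure topological group theory about OUR carrier `Π_C = (TG l)^∧`, `TG l = ((ℤ/l)² ⋊ D_∞) × ℤ/2`). The obstruction
named by abc-iut-f-108 g4 («the `Ẑ^×`-scalings `t ↦ t^u` of the loop are NOT completions of tempered automorphisms») is met WITHOUT
coordinates: for EVERY topological automorphism `ρ` of the rotation closure `R ⊆ Π_C`,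
* `rotIdx_Phi_rho` — `ρ` multiplies the rotation index `λ = rotIdx ∘ Φ` on `R` by the constant `c = λ(ρ(η t))`, a unit with inverse
  `λ(ρ⁻¹(η t))` (`rotIdx_Phi_rho_mul_symm`) — density of `η⟨t⟩` in `R`;
* `exists_hatScaling` — there is a continuous endomorphism `Σ_ρ` of `Π_C` with `Σ_ρ|_R = ρ`, `Σ_ρ(η ι) = η ι`, `Σ_ρ` fixing the sheet
  factor `η(1, e)` and `Σ_ρ(η inl(b, c)) = η inl(u b, c)`, `u = λ(ρ⁻¹(η t))`: the assignment `t ↦ ρ(η t)`, `ι ↦ η ι`,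
  `(b, c) ↦ (u b, c)`, `e ↦ e` respects the relations of `((ℤ/l)² ⋊ D_∞) × ℤ/2` (part 1: `R` is abelian, inverted by `η ι`, and
  acts on `η((ℤ/l)²)` by `(b, c) ↦ (b, c + λ b)`), so it is a homomorphism `TG l → Π_C` (`SemidirectProduct.lift`,
  `exists_monoidHom_dihedralZero`, `MonoidHom.noncommCoprod`) and extends to the completion by the universal property;
* `exists_hatScalingEquiv` — `Σ_{ρ⁻¹} ∘ Σ_ρ = id` (generation lemma + density), so `Σ_ρ` is a topological AUTOMORPHISM of `Π_C`.
Sequel: part 3 `Sec2MonodromyModelHatScalingsStabilise.lean` (the `Σ_ρ` stabilise the closures of the tower's members).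

HONEST LABEL (abc-iut-L2-lead R1352, inherited from the carrier): «a DESIGNED tempered toy with print's monodromy combinatorics —
loop ↦ `Δ̄^ell` (`b`-cycle), the inversion INVERTS it, unipotent monodromy `x ↦ x·z` on the `a`-cycle, `z` = cusp inertia = `Δ̄_Θ`
central; `G_K := 1`; NOT a Tate curve, NOT the tempered fundamental group of a curve; consistency ≠ faithfulness.» PROOF-ONLY
companion (0 `def`, 0 `instance`, 0 notation, 0 `Prop`-definition; nothing of abc-iut-w6-d084's model files or of abc-iut-L2-t2's
interface is edited or restated). Instance-at-OUR-carrier ≠ [EtTh] Prop. 2.6 for the profinite fundamental groups of a curve;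
typed ≠ proved; no side is taken on [IUTchIII] Cor. 3.12 or on any author; nothing here asserts abc proved or refuted.
-/

noncomputable section

namespace Literature.AnabelianGeometry.EtaleTheta.ThetaCovers.MonodromyModel

open Multiplicative HeisenbergWitness TemperedModel DihedralGroup Topology
open Literature.AnabelianGeometry.SemiGraphs

variable (l : ℕ)

/-! ## 2. The scaling extensions `σ_ρ` of the automorphisms `ρ` of the rotation closure -/

section Scaling

/-- `ι · inl(w) · ι⁻¹ = inl(s · w)` (`(b, c) ↦ (−b, c)`). (toy bookkeeping for [EtTh] Rmk. 2.1.1; no claim about print)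
[cite: MochizukiEtTh2009, Rmk 2.1.1 p.36] -/
theorem iotaT_conj_inl (w : Multiplicative (ZMod l × ZMod l)) :
    MulAut.conj (iotaT l) ((SemidirectProduct.inl w : TG₀ l), (1 : Multiplicative (ZMod 2))) =
      ((SemidirectProduct.inl (act l (-1) 0 w) : TG₀ l), (1 : Multiplicative (ZMod 2))) := by
  rw [MulAut.conj_apply]
  refine TG.ext l ?_ ?_ ?_ ?_
  · simp
  · simp
  · simp
  · simp

variable [NeZero l]

/-- `λ := rotIdx ∘ Φ` is continuous (locally constant). (toy bookkeeping; no claim about print) [cite: MochizukiEtTh2009, §1 p.12] -/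
theorem continuous_rotIdx_Phi : Continuous (fun x : PiC l => rotIdx l (Phi l x).right) := by
  have e : (fun x : PiC l => rotIdx l (Phi l x).right) = (fun a : TA l => rotIdx l (TA.heis l a).right) ∘ Sh l := rfl
  rw [e]
  exact continuous_of_discreteTopology.comp (Sh l).continuous

/-- `λ` is additive on the rotation closure. (toy bookkeeping; no claim about print) [cite: MochizukiEtTh2009, §1 p.12] -/
theorem rotIdx_Phi_mul_of_mem_rot {R : Subgroup (PiC l)}
    (hR : R = ((Subgroup.zpowers (embCu l (1, r 1))).map (toHat l).toMonoidHom).topologicalClosure)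
    {x y : PiC l} (hx : x ∈ R) (hy : y ∈ R) :
    rotIdx l (Phi l (x * y)).right = rotIdx l (Phi l x).right + rotIdx l (Phi l y).right := by
  obtain ⟨i, hi⟩ := exists_Phi_eq_inr_r_of_mem_rot l hR hx
  obtain ⟨j, hj⟩ := exists_Phi_eq_inr_r_of_mem_rot l hR hy
  rw [map_mul, hi, hj, ← map_mul, SemidirectProduct.right_inr, SemidirectProduct.right_inr,
    SemidirectProduct.right_inr, r_mul_r, rotIdx_r, rotIdx_r, rotIdx_r]

/-- `λ(η t) = 1`. (toy bookkeeping; no claim about print) [cite: MochizukiEtTh2009, §1 p.12] -/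
theorem rotIdx_Phi_toHat_t : rotIdx l (Phi l (toHat l (embCu l (1, r 1)))).right = 1 := by
  have h := Phi_toHat_t_zpow l 1
  rw [zpow_one] at h
  rw [h, SemidirectProduct.right_inr, rotIdx_r, Int.cast_one]

/-- **An automorphism `ρ` of the rotation closure multiplies `λ` by the constant `λ(ρ(η t))`.** (toy bookkeeping;
no claim about print) [cite: MochizukiEtTh2009, Prop 2.6 p.40] -/
theorem rotIdx_Phi_rho {R : Subgroup (PiC l)}
    (hR : R = ((Subgroup.zpowers (embCu l (1, r 1))).map (toHat l).toMonoidHom).topologicalClosure)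
    (ρ : ↥R ≃ₜ* ↥R) (x : ↥R) :
    rotIdx l (Phi l (ρ x : PiC l)).right =
      rotIdx l (Phi l x).right * rotIdx l (Phi l (ρ ⟨toHat l (embCu l (1, r 1)), toHat_t_mem l hR⟩ : PiC l)).right := by
  -- `λ` as a homomorphism on `R`
  let lam : ↥R →* Multiplicative (ZMod l) :=
    { toFun := fun x => ofAdd (rotIdx l (Phi l (x : PiC l)).right)
      map_one' := by simp
      map_mul' := fun x y => by
        rw [← ofAdd_add, Subgroup.coe_mul, rotIdx_Phi_mul_of_mem_rot l hR x.2 y.2] }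
  have hlam : ∀ x : ↥R, rotIdx l (Phi l (x : PiC l)).right = toAdd (lam x) := fun x => rfl
  set c := rotIdx l (Phi l (ρ ⟨toHat l (embCu l (1, r 1)), toHat_t_mem l hR⟩ : PiC l)).right with hc
  subst hR
  have key := eq_of_eqOn_subgroup_of_continuous ((Subgroup.zpowers (embCu l (1, r 1))).map (toHat l).toMonoidHom)
    (f := fun x => rotIdx l (Phi l (ρ x : PiC l)).right) (g := fun x => rotIdx l (Phi l (x : PiC l)).right * c)
    ((continuous_rotIdx_Phi l).comp (continuous_subtype_val.comp ρ.continuous))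
    (((continuous_rotIdx_Phi l).comp continuous_subtype_val).mul continuous_const) ?_
  · exact congrFun key x
  · intro y hy
    obtain ⟨k, rfl⟩ := (mem_map_zpowers_iff l).mp hy
    have hpow : (⟨toHat l (embCu l (1, r 1) ^ k), Subgroup.le_topologicalClosure _ hy⟩ :
        ↥((Subgroup.zpowers (embCu l (1, r 1))).map (toHat l).toMonoidHom).topologicalClosure) =
        ⟨toHat l (embCu l (1, r 1)), toHat_t_mem l rfl⟩ ^ k := by
      apply Subtype.ext
      simp only [SubgroupClass.coe_zpow, map_zpow]
    change rotIdx l (Phi l (ρ _ : PiC l)).right = rotIdx l (Phi l (toHat l (embCu l (1, r 1) ^ k))).right * c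
    rw [hpow, map_zpow, hlam, map_zpow, toAdd_zpow, ← hlam, Phi_toHat_t_zpow, SemidirectProduct.right_inr, rotIdx_r,
      zsmul_eq_mul, mul_comm]

/-- The multiplier of `ρ` is a unit, with inverse the multiplier of `ρ⁻¹`. (toy bookkeeping; no claim about print)
[cite: MochizukiEtTh2009, Prop 2.6 p.40] -/
theorem rotIdx_Phi_rho_mul_symm {R : Subgroup (PiC l)}
    (hR : R = ((Subgroup.zpowers (embCu l (1, r 1))).map (toHat l).toMonoidHom).topologicalClosure)
    (ρ : ↥R ≃ₜ* ↥R) :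
    rotIdx l (Phi l (ρ ⟨toHat l (embCu l (1, r 1)), toHat_t_mem l hR⟩ : PiC l)).right *
      rotIdx l (Phi l (ρ.symm ⟨toHat l (embCu l (1, r 1)), toHat_t_mem l hR⟩ : PiC l)).right = 1 := by
  have h := rotIdx_Phi_rho l hR ρ (ρ.symm ⟨toHat l (embCu l (1, r 1)), toHat_t_mem l hR⟩)
  rw [ContinuousMulEquiv.apply_symm_apply] at h
  change rotIdx l (Phi l (toHat l (embCu l (1, r 1)))).right = _ at h
  rw [rotIdx_Phi_toHat_t] at h
  rw [mul_comm]
  exact h.symm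

/-- **THE SCALING EXTENSION.** Every topological automorphism `ρ` of the rotation closure `R = cl(η⟨t⟩) ⊆ Π_C` is the
restriction of a continuous endomorphism `σ_ρ` of `Π_C = (TG l)^∧` fixing `η(ι)` and the sheet factor `η(e)` and acting
on `η((ℤ/l)²)` by `(b, c) ↦ (u b, c)`, `u = λ(ρ⁻¹(η t)) ∈ (ℤ/l)ˣ` — built from the universal property of the completion
applied to `t ↦ ρ(η t)`, `ι ↦ η ι`, `(b, c) ↦ (u b, c)`, `e ↦ e` (the relations of `((ℤ/l)² ⋊ D_∞) × ℤ/2` hold because `R` is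
abelian, inverted by `η ι`, and acts on `η((ℤ/l)²)` through the rotation index). These are the «`Ẑ^×`-scalings of the loop»
without coordinates on `(TG l)^∧`. (toy bookkeeping for [EtTh] Prop. 2.6, profinite clause, at the model; no claim about print)
[cite: MochizukiEtTh2009, Prop 2.6 p.40] -/
theorem exists_hatScaling {R : Subgroup (PiC l)}
    (hR : R = ((Subgroup.zpowers (embCu l (1, r 1))).map (toHat l).toMonoidHom).topologicalClosure)
    (ρ : ↥R ≃ₜ* ↥R) :
    ∃ σ : PiC l →ₜ* PiC l, ∃ u : (ZMod l)ˣ,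
      (u : ZMod l) = rotIdx l (Phi l (ρ.symm ⟨toHat l (embCu l (1, r 1)), toHat_t_mem l hR⟩ : PiC l)).right ∧
      (∀ x : ↥R, σ x = ρ x) ∧
      (∀ v, σ (toHat l ((SemidirectProduct.inl v : TG₀ l), 1)) =
        toHat l ((SemidirectProduct.inl (act l u 0 v) : TG₀ l), 1)) ∧
      σ (iotaM l) = iotaM l ∧
      (∀ e : Multiplicative (ZMod 2), σ (toHat l ((1 : TG₀ l), e)) = toHat l ((1 : TG₀ l), e)) := by
  set tH : ↥R := ⟨toHat l (embCu l (1, r 1)), toHat_t_mem l hR⟩ with htH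
  set c := rotIdx l (Phi l (ρ tH : PiC l)).right with hc
  set c' := rotIdx l (Phi l (ρ.symm tH : PiC l)).right with hc'
  have hcc' : c * c' = 1 := rotIdx_Phi_rho_mul_symm l hR ρ
  let u : (ZMod l)ˣ := Units.mkOfMulEqOne c' c (by rw [mul_comm]; exact hcc')
  have hu : (u : ZMod l) = c' := rfl
  -- the generators' images
  set x₀ : PiC l := (ρ tH : PiC l) with hx₀
  have hx₀R : x₀ ∈ R := (ρ tH).2
  have hy : iotaM l * iotaM l = 1 := iotaM_mul_self l
  have hxy : iotaM l * x₀ * (iotaM l)⁻¹ = x₀⁻¹ := iotaM_conj_of_mem_rot l hR hx₀R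
  obtain ⟨fD, hfDr, hfDsr⟩ := exists_monoidHom_dihedralZero x₀ (iotaM l) hy hxy
  -- `λ(x₀^i) = i c`
  have hlam_pow : ∀ i : ℤ, rotIdx l (Phi l (x₀ ^ i)).right = (i : ZMod l) * c := by
    intro i
    have h := rotIdx_Phi_rho l hR ρ (tH ^ i)
    rw [← htH, map_zpow, SubgroupClass.coe_zpow, SubgroupClass.coe_zpow, ← hx₀, ← hc] at h
    rw [h]
    change rotIdx l (Phi l (toHat l (embCu l (1, r 1)) ^ i)).right * c = _
    rw [← map_zpow, Phi_toHat_t_zpow, SemidirectProduct.right_inr, rotIdx_r]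
  let inlH : Multiplicative (ZMod l × ZMod l) →* TG l :=
    (MonoidHom.inl (TG₀ l) (Multiplicative (ZMod 2))).comp SemidirectProduct.inl
  have hinlH : ∀ v, inlH v = ((SemidirectProduct.inl v : TG₀ l), (1 : Multiplicative (ZMod 2))) := fun v => rfl
  let fN : Multiplicative (ZMod l × ZMod l) →* PiC l :=
    (toHat l).toMonoidHom.comp (inlH.comp (act l u 0).toMonoidHom)
  have hfN : ∀ v, fN v = toHat l ((SemidirectProduct.inl (act l u 0 v) : TG₀ l), 1) := fun v => rfl
  have compat : ∀ d, fN.comp (thetaInf l d).toMonoidHom = (MulAut.conj (fD d)).toMonoidHom.comp fN := by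
    intro d
    refine MonoidHom.ext fun v => ?_
    change fN (thetaInf l d v) = MulAut.conj (fD d) (fN v)
    rw [hfN, hfN, MulAut.conj_apply]
    rcases d with i | i
    · rw [hfDr, conj_toHat_inl_of_mem_rot l hR (Subgroup.zpow_mem _ hx₀R _), hlam_pow, thetaInf_apply, dihedralRed_r,
        theta_r]
      congr 3
      apply toAdd.injective
      refine Prod.ext ?_ ?_
      · simp
      · simp only [toAdd_act_snd, toAdd_act_fst, Units.val_one, one_mul, hu]
        rw [show (ZMod.castHom (dvd_zero l) (ZMod l)) i = ((show ℤ from i : ℤ) : ZMod l) from rfl]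
        linear_combination (-(((show ℤ from i : ℤ) : ZMod l) * (toAdd v).1)) * hcc'
    · rw [hfDsr, show iotaM l * x₀ ^ (show ℤ from i) * toHat l ((SemidirectProduct.inl (act l u 0 v) : TG₀ l), 1) *
          (iotaM l * x₀ ^ (show ℤ from i))⁻¹ = iotaM l * (x₀ ^ (show ℤ from i) *
          toHat l ((SemidirectProduct.inl (act l u 0 v) : TG₀ l), 1) * (x₀ ^ (show ℤ from i))⁻¹) * (iotaM l)⁻¹ by group,
        conj_toHat_inl_of_mem_rot l hR (Subgroup.zpow_mem _ hx₀R _), hlam_pow, iotaM, ← map_mul, ← map_inv, ← map_mul,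
        ← MulAut.conj_apply, iotaT_conj_inl, thetaInf_apply, dihedralRed_sr, theta_sr]
      congr 3
      apply toAdd.injective
      refine Prod.ext ?_ ?_
      · simp
      · simp only [toAdd_act_snd, toAdd_act_fst, Units.val_one, one_mul, hu, Units.val_neg]
        rw [show (ZMod.castHom (dvd_zero l) (ZMod l)) i = ((show ℤ from i : ℤ) : ZMod l) from rfl]
        linear_combination (-(((show ℤ from i : ℤ) : ZMod l) * (toAdd v).1)) * hcc'
  let F₀ : TG₀ l →* PiC l := SemidirectProduct.lift fN fD compat
  let fE : Multiplicative (ZMod 2) →* PiC l := (toHat l).toMonoidHom.comp (MonoidHom.inr (TG₀ l) (Multiplicative (ZMod 2)))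
  have hfE : ∀ e, fE e = toHat l ((1 : TG₀ l), e) := fun e => rfl
  have hdense : DenseRange (toHat l) := ProfiniteGrp.ProfiniteCompletion.denseRange (G := GrpCat.of (TG l))
  have comm : ∀ m n, Commute (F₀ m) (fE n) := by
    intro m n
    obtain ⟨X, hX⟩ : ∃ X : TG l, X = ((1 : TG₀ l), n) := ⟨_, rfl⟩
    have hX1 : X.1.right = 1 := by rw [hX]; rfl
    have hX2 : bC l X = 0 := by rw [hX]; rfl
    have hX3 : cC l X = 0 := by rw [hX]; rfl
    have hX4 : X.2 = n := by rw [hX]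
    have hcen : ∀ g : TG l, X * g = g * X := fun g =>
      TG.ext l (by simp [hX1]) (by simp [hX1, hX2]) (by simp [hX1, hX2, hX3]) (by rw [snd_mul, snd_mul, hX4, mul_comm])
    have hfe : fE n = toHat l X := by rw [hX]; rfl
    rw [hfe]
    refine (commute_of_denseRange (η := (toHat l).toMonoidHom) hdense (toHat l X) (fun g => ?_) (F₀ m)).symm
    change Commute (toHat l X) (toHat l g)
    rw [commute_iff_eq, ← map_mul, hcen g, map_mul]
  let F : TG l →* PiC l := MonoidHom.noncommCoprod F₀ fE comm
  have hF : ∀ g : TG l, F g = F₀ g.1 * fE g.2 := fun g => rfl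
  obtain ⟨σ, hσ⟩ := exists_continuousMonoidHom_extend_profinite (TG l)
    (ProfiniteGrp.ProfiniteCompletion.completion (GrpCat.of (TG l))) F
  have hσ' : ∀ g : TG l, σ (toHat l g) = F g := hσ
  -- values on generators
  have hσt1 : σ (toHat l (embCu l (1, r 1))) = x₀ := by
    rw [hσ', hF]
    change F₀ (SemidirectProduct.inr (r 1)) * fE 1 = _
    rw [map_one, mul_one, SemidirectProduct.lift_inr, hfDr]
    exact (zpow_one x₀ : x₀ ^ (1 : ℤ) = x₀)
  have hσt : ∀ k : ℤ, σ (toHat l (embCu l (1, r 1) ^ k)) = x₀ ^ k := by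
    intro k
    rw [map_zpow, map_zpow, hσt1]
  refine ⟨σ, u, hu, ?_, fun v => ?_, ?_, fun e => ?_⟩
  · -- restriction to `R` is `ρ`: density in `R`
    intro x
    subst hR
    have key := eq_of_eqOn_subgroup_of_continuous ((Subgroup.zpowers (embCu l (1, r 1))).map (toHat l).toMonoidHom)
      (f := fun x => σ (x : PiC l)) (g := fun x => (ρ x : PiC l)) (σ.continuous.comp continuous_subtype_val)
      (continuous_subtype_val.comp ρ.continuous) ?_
    · exact congrFun key x
    · intro y hy
      obtain ⟨k, rfl⟩ := (mem_map_zpowers_iff l).mp hy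
      have hpow : (⟨toHat l (embCu l (1, r 1) ^ k), Subgroup.le_topologicalClosure _ hy⟩ :
          ↥((Subgroup.zpowers (embCu l (1, r 1))).map (toHat l).toMonoidHom).topologicalClosure) = tH ^ k := by
        apply Subtype.ext
        simp only [SubgroupClass.coe_zpow, htH, map_zpow]
      change σ (toHat l (embCu l (1, r 1) ^ k)) = (ρ _ : PiC l)
      rw [hσt, hpow, map_zpow, SubgroupClass.coe_zpow]
  · rw [hσ', hF]
    change F₀ (SemidirectProduct.inl v) * fE 1 = _
    rw [map_one, mul_one, SemidirectProduct.lift_inl, hfN]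
  · rw [iotaM, hσ', hF]
    change F₀ (SemidirectProduct.inr (sr 0)) * fE 1 = _
    rw [map_one, mul_one, SemidirectProduct.lift_inr, hfDsr]
    change iotaM l * x₀ ^ (0 : ℤ) = iotaM l
    rw [zpow_zero, mul_one]
  · rw [hσ', hF]
    change F₀ 1 * fE e = _
    rw [map_one, one_mul, hfE]

/-- **THE SCALING AUTOMORPHISMS.** For every topological automorphism `ρ` of the rotation closure `R ⊆ Π_C` there is a
topological automorphism `Σ` of `Π_C = (TG l)^∧` restricting to `ρ` on `R` (and to `ρ⁻¹` for `Σ⁻¹`), scaling the `a`-cycle by the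
unit `u = λ(ρ⁻¹(η t))` (resp. `u⁻¹`), and fixing `η(ι)` and the sheet factor — the inverse of `Σ_ρ` is `Σ_{ρ⁻¹}` by the
generation lemma and density. (toy bookkeeping for [EtTh] Prop. 2.6, profinite clause, at the model; no claim about print)
[cite: MochizukiEtTh2009, Prop 2.6 p.40] -/
theorem exists_hatScalingEquiv {R : Subgroup (PiC l)}
    (hR : R = ((Subgroup.zpowers (embCu l (1, r 1))).map (toHat l).toMonoidHom).topologicalClosure)
    (ρ : ↥R ≃ₜ* ↥R) :
    ∃ S : PiC l ≃ₜ* PiC l, ∃ u : (ZMod l)ˣ,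
      (∀ x : ↥R, S x = ρ x) ∧ (∀ x : ↥R, S.symm x = ρ.symm x) ∧
      (∀ v, S (toHat l ((SemidirectProduct.inl v : TG₀ l), 1)) = toHat l ((SemidirectProduct.inl (act l u 0 v) : TG₀ l), 1)) ∧
      (∀ v, S.symm (toHat l ((SemidirectProduct.inl v : TG₀ l), 1)) =
        toHat l ((SemidirectProduct.inl (act l u⁻¹ 0 v) : TG₀ l), 1)) ∧
      S (iotaM l) = iotaM l ∧ S.symm (iotaM l) = iotaM l ∧
      (∀ e : Multiplicative (ZMod 2), S (toHat l ((1 : TG₀ l), e)) = toHat l ((1 : TG₀ l), e)) ∧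
      (∀ e : Multiplicative (ZMod 2), S.symm (toHat l ((1 : TG₀ l), e)) = toHat l ((1 : TG₀ l), e)) := by
  obtain ⟨σ, u, hu, hσR, hσinl, hσι, hσe⟩ := exists_hatScaling l hR ρ
  obtain ⟨σ', u', hu', hσ'R, hσ'inl, hσ'ι, hσ'e⟩ := exists_hatScaling l hR ρ.symm
  have huu' : (u : ZMod l) * u' = 1 := by
    rw [hu, hu', ContinuousMulEquiv.symm_symm, mul_comm]
    exact rotIdx_Phi_rho_mul_symm l hR ρ
  have hu'u : u' = u⁻¹ := by
    rw [eq_comm, inv_eq_iff_mul_eq_one]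
    exact Units.ext huu'
  have hdense : DenseRange (toHat l) := ProfiniteGrp.ProfiniteCompletion.denseRange (G := GrpCat.of (TG l))
  -- `σ' ∘ σ = id` and `σ ∘ σ' = id`
  have hinv : ∀ (σ₁ σ₂ : PiC l →ₜ* PiC l) (ρ₁ ρ₂ : ↥R ≃ₜ* ↥R) (u₁ u₂ : (ZMod l)ˣ), ρ₂ = ρ₁.symm → (u₁ : ZMod l) * u₂ = 1 →
      (∀ x : ↥R, σ₁ x = ρ₁ x) → (∀ x : ↥R, σ₂ x = ρ₂ x) →
      (∀ v, σ₁ (toHat l ((SemidirectProduct.inl v : TG₀ l), 1)) = toHat l ((SemidirectProduct.inl (act l u₁ 0 v) : TG₀ l), 1)) →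
      (∀ v, σ₂ (toHat l ((SemidirectProduct.inl v : TG₀ l), 1)) = toHat l ((SemidirectProduct.inl (act l u₂ 0 v) : TG₀ l), 1)) →
      σ₁ (iotaM l) = iotaM l → σ₂ (iotaM l) = iotaM l →
      (∀ e : Multiplicative (ZMod 2), σ₁ (toHat l ((1 : TG₀ l), e)) = toHat l ((1 : TG₀ l), e)) →
      (∀ e : Multiplicative (ZMod 2), σ₂ (toHat l ((1 : TG₀ l), e)) = toHat l ((1 : TG₀ l), e)) →
      ∀ y, σ₂ (σ₁ y) = y := by
    intro σ₁ σ₂ ρ₁ ρ₂ u₁ u₂ hρ hu₁₂ h1R h2R h1inl h2inl h1ι h2ι h1e h2e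
    have key : (σ₂.toMonoidHom.comp σ₁.toMonoidHom).comp (toHat l).toMonoidHom =
        (MonoidHom.id (PiC l)).comp (toHat l).toMonoidHom := by
      refine monoidHom_TG_ext l (fun v => ?_) ?_ ?_ (fun e => ?_)
      · change σ₂ (σ₁ (toHat l _)) = toHat l _
        rw [h1inl, h2inl]
        congr 3
        apply toAdd.injective
        refine Prod.ext ?_ ?_
        · simp only [toAdd_act_fst]
          rw [← mul_assoc, mul_comm (u₂ : ZMod l), hu₁₂, one_mul]
        · simp
      · change σ₂ (σ₁ (toHat l (embCu l (1, r 1)))) = toHat l (embCu l (1, r 1))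
        have e1 := h1R ⟨toHat l (embCu l (1, r 1)), toHat_t_mem l hR⟩
        have e2 := h2R (ρ₁ ⟨toHat l (embCu l (1, r 1)), toHat_t_mem l hR⟩)
        rw [hρ, ContinuousMulEquiv.symm_apply_apply] at e2
        change σ₁ (toHat l (embCu l (1, r 1))) = _ at e1
        rw [e1, e2]
      · change σ₂ (σ₁ (toHat l (iotaT l))) = toHat l (iotaT l)
        rw [← iotaM, h1ι, h2ι]
      · change σ₂ (σ₁ (toHat l _)) = toHat l _
        rw [h1e, h2e]
    have key' := hdense.equalizer (σ₂.continuous.comp σ₁.continuous) continuous_id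
      (funext fun g => DFunLike.congr_fun key g)
    exact fun y => congrFun key' y
  have h1 := hinv σ σ' ρ ρ.symm u u' rfl huu' hσR hσ'R hσinl hσ'inl hσι hσ'ι hσe hσ'e
  have h2 := hinv σ' σ ρ.symm ρ u' u (ContinuousMulEquiv.symm_symm ρ).symm (by rw [mul_comm]; exact huu') hσ'R hσR hσ'inl
    hσinl hσ'ι hσι hσ'e hσe
  let S : PiC l ≃ₜ* PiC l :=
    { toFun := σ
      invFun := σ'
      left_inv := h1
      right_inv := h2
      map_mul' := map_mul σ
      continuous_toFun := σ.continuous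
      continuous_invFun := σ'.continuous }
  refine ⟨S, u, hσR, hσ'R, hσinl, fun v => ?_, hσι, hσ'ι, hσe, hσ'e⟩
  change σ' _ = _
  rw [hσ'inl, hu'u]

end Scaling

end Literature.AnabelianGeometry.EtaleTheta.ThetaCovers.MonodromyModel

end
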